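import Summits.Ventures.PercRepro.StarGadgetGraphProfiles
import Summits.Ventures.PercRepro.Decide
import Summits.Ventures.PercRepro.HJoin
import Summits.Ventures.PercRepro.ReachFromRel

/-!
# Branch catalogues — the gluing of branches at four terminals (the branch-catalogue theorem, module 1)

A CATALOGUE is a finite type `C` of branch types, each with a finite vertex type `BV τ`, a finite
edge type `BE τ` and a LOCAL multigraph `loc τ` on `Fin 4 ⊕ BV τ` — the four terminals
`a b c x = 0 1 2 3` and the branch's own vertices; an edge may join a terminal to a branch vertex,
two branch vertices, or two terminals (the edge `c – x` is the catalogue type with no vertex and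
one edge).  With multiplicities `m : C → ℕ`, the GADGET `catGadget loc m` glues `m τ` copies of each
branch type at the terminals: its vertices are the terminals and the branch vertices `⟨b, v⟩`,
its edges the branch edges `⟨b, e⟩`.  The star gadget (hubs) and the pure-pair gadget are instances.

The LOCAL vocabulary of a branch state `s : BE τ → Bool` in a mode `μ` (the mark the centre
attaches to): `localBot` (no two marks connected inside the branch), `attTo` / `att` (the mark the
branch connects to `x`), `inClLoc` (the cluster of a mark, by Lemma 2 of the profile theorem),
`hadjLoc` (the within-branch H-step), `hconnAvoidLoc` (within-branch H-walks avoiding the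
avoided set), the detour fact `Dloc` and the witness `Wloc`.  All are decidable.
-/

namespace PercRepro.CatGraph

open MultiGraph StarGadgetGraph

section Catalogue

variable {C : Type} {BV BE : C → Type}

/-- The branches of the gadget: `m τ` copies of each type. -/
abbrev Br (m : C → ℕ) := Σ τ : C, Fin (m τ)

/-- The vertices: the four terminals and the branch vertices. -/
abbrev CV (BV : C → Type) (m : C → ℕ) := Fin 4 ⊕ Σ b : Br m, BV b.1

/-- The edges: the branch edges. -/
abbrev CE (BE : C → Type) (m : C → ℕ) := Σ b : Br m, BE b.1

variable {m : C → ℕ}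

/-- The embedding of the local vertices of the branch `b` into the gadget. -/
def emb (b : Br m) : Fin 4 ⊕ BV b.1 → CV BV m
  | .inl i => .inl i
  | .inr v => .inr ⟨b, v⟩

/-- The terminal `i` as a vertex. -/
def cen (i : Fin 4) : CV BV m := .inl i

/-- The mark `m'` as a vertex. -/
def vm (m' : Fin 3) : CV BV m := .inl m'.castSucc

/-- The centre `x` as a vertex. -/
def vx : CV BV m := .inl 3

/-- The terminals. -/
def Cen (BV : C → Type) (m : C → ℕ) : Set (CV BV m) := Set.range Sum.inl

/-- The part of an edge: its branch. -/
def pe (e : CE BE m) : Option (Br m) := some e.1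

/-- The branch of a vertex (`none` for a terminal). -/
def br : CV BV m → Option (Br m)
  | .inl _ => none
  | .inr ⟨b, _⟩ => some b

/-- **The gadget of a catalogue**: the endpoints of a branch edge are its local endpoints embedded. -/
def catGadget (loc : ∀ τ, MultiGraph (Fin 4 ⊕ BV τ) (BE τ)) (m : C → ℕ) : MultiGraph (CV BV m) (CE BE m) where
  fst e := emb e.1 ((loc e.1.1).fst e.2)
  snd e := emb e.1 ((loc e.1.1).snd e.2)

/-- The state of the branch `b` in a configuration. -/
def brState (σ : Config (CE BE m)) (b : Br m) : BE b.1 → Bool := fun e => σ ⟨b, e⟩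

/-- The terminals are `Cen`. -/
theorem cen_mem_cen (i : Fin 4) : (cen i : CV BV m) ∈ Cen BV m := ⟨i, rfl⟩

/-- A branch vertex is not a terminal. -/
theorem emb_inr_not_mem_cen (b : Br m) (v : BV b.1) : (emb b (.inr v) : CV BV m) ∉ Cen BV m := by
  rintro ⟨i, hi⟩; cases hi

/-- `emb` of a terminal is the terminal. -/
theorem emb_inl (b : Br m) (i : Fin 4) : (emb b (.inl i) : CV BV m) = cen i := rfl

/-- Every edge at a non-terminal lies in that vertex's branch (the part hypothesis of the join
lemmas). -/
theorem hpart (loc : ∀ τ, MultiGraph (Fin 4 ⊕ BV τ) (BE τ)) (m : C → ℕ) : ∀ e : CE BE m,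
    ((catGadget loc m).fst e ∉ Cen BV m → pe e = br ((catGadget loc m).fst e)) ∧
      ((catGadget loc m).snd e ∉ Cen BV m → pe e = br ((catGadget loc m).snd e)) := by
  intro e
  constructor
  · intro h
    have h' : emb e.1 ((loc e.1.1).fst e.2) ∉ Cen BV m := h
    show some e.1 = br (emb e.1 ((loc e.1.1).fst e.2))
    revert h'
    cases (loc e.1.1).fst e.2 with
    | inl i => intro h'; exact absurd (cen_mem_cen i) h'
    | inr v => intro _; rfl
  · intro h
    have h' : emb e.1 ((loc e.1.1).snd e.2) ∉ Cen BV m := h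
    show some e.1 = br (emb e.1 ((loc e.1.1).snd e.2))
    revert h'
    cases (loc e.1.1).snd e.2 with
    | inl i => intro h'; exact absurd (cen_mem_cen i) h'
    | inr v => intro _; rfl

/-- Every terminal is one of `a b c x`. -/
theorem cen_cases' (t : CV BV m) (ht : t ∈ Cen BV m) :
    t = cen 0 ∨ t = cen 1 ∨ t = cen 2 ∨ t = cen 3 := by
  obtain ⟨i, rfl⟩ := ht
  fin_cases i <;> simp [cen]

end Catalogue

/-! ### The local vocabulary of a branch type -/

section Local

variable {C : Type} {BV BE : C → Type} [∀ τ, Fintype (BV τ)] [∀ τ, DecidableEq (BV τ)]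
  [∀ τ, Fintype (BE τ)] [∀ τ, DecidableEq (BE τ)]
  (loc : ∀ τ, MultiGraph (Fin 4 ⊕ BV τ) (BE τ))

/-- Local connectivity is decidable. -/
instance (τ : C) (s : BE τ → Bool) : DecidableRel ((loc τ).Conn s) := inferInstance

/-- No two marks are connected inside the branch. -/
def localBot (τ : C) (s : BE τ → Bool) : Prop :=
  ∀ i j : Fin 3, i ≠ j → ¬ (loc τ).Conn s (.inl i.castSucc) (.inl j.castSucc)

/-- `localBot` is decidable. -/
instance (τ : C) (s : BE τ → Bool) : Decidable (localBot loc τ s) := by unfold localBot; infer_instance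

/-- The branch connects the mark `m'` to the centre. -/
def attTo (τ : C) (s : BE τ → Bool) (m' : Fin 3) : Prop := (loc τ).Conn s (.inl m'.castSucc) (.inl 3)

/-- `attTo` is decidable. -/
instance (τ : C) (s : BE τ → Bool) (m' : Fin 3) : Decidable (attTo loc τ s m') := by
  unfold attTo; infer_instance

/-- The mark the branch connects to the centre (the first one, if any). -/
def att (τ : C) (s : BE τ → Bool) : Mode :=
  if attTo loc τ s 0 then some 0 else if attTo loc τ s 1 then some 1 else
    if attTo loc τ s 2 then some 2 else none

/-- The states allowed in mode `μ`: `localBot`, and the attachment (if any) is the mode's mark. -/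
def allowedLoc (μ : Mode) (τ : C) (s : BE τ → Bool) : Prop :=
  localBot loc τ s ∧ (att loc τ s = none ∨ att loc τ s = μ)

/-- `allowedLoc` is decidable. -/
instance (μ : Mode) (τ : C) (s : BE τ → Bool) : Decidable (allowedLoc loc μ τ s) := by
  unfold allowedLoc; infer_instance

/-- The witness of the mode: the branch attaches the mode's mark to the centre. -/
def Wloc (μ : Mode) (τ : C) (s : BE τ → Bool) : Prop := ∃ m', μ = some m' ∧ att loc τ s = some m'

/-- `Wloc` is decidable. -/
instance (μ : Mode) (τ : C) (s : BE τ → Bool) : Decidable (Wloc loc μ τ s) := by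
  unfold Wloc; infer_instance

/-- A local vertex lies in the open cluster of the mark `m'` (Lemma 2): connected to `m'` inside the
branch, or — when the centre attaches to `m'` — connected to the centre inside the branch. -/
def inClLoc (μ : Mode) (τ : C) (m' : Fin 3) (s : BE τ → Bool) (v : Fin 4 ⊕ BV τ) : Prop :=
  (loc τ).Conn s (.inl m'.castSucc) v ∨ (μ = some m' ∧ (loc τ).Conn s (.inl 3) v)

/-- `inClLoc` is decidable. -/
instance (μ : Mode) (τ : C) (m' : Fin 3) (s : BE τ → Bool) (v : Fin 4 ⊕ BV τ) :
    Decidable (inClLoc loc μ τ m' s v) := by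
  unfold inClLoc; infer_instance

/-- The local avoided set: `none` avoids nothing, `some m'` avoids the cluster of `m'`. -/
def inXLoc (μ : Mode) (τ : C) (X : Option (Fin 3)) (s : BE τ → Bool) (v : Fin 4 ⊕ BV τ) : Prop :=
  ∃ m', X = some m' ∧ inClLoc loc μ τ m' s v

/-- `inXLoc` is decidable. -/
instance (μ : Mode) (τ : C) (X : Option (Fin 3)) (s : BE τ → Bool) (v : Fin 4 ⊕ BV τ) :
    Decidable (inXLoc loc μ τ X s v) := by
  unfold inXLoc; infer_instance

/-- `Joins` of a local graph is decidable. -/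
instance (τ : C) (e : BE τ) (u v : Fin 4 ⊕ BV τ) : Decidable ((loc τ).Joins e u v) := by
  unfold Joins; infer_instance

/-- The within-branch H-step in mode `μ`: a closed branch edge inside `M`, a branch edge across the
boundary of `M`, or local connectivity outside `M` (`M` = the cluster of `c`, read locally). -/
def hadjLoc (μ : Mode) (τ : C) (s : BE τ → Bool) (u v : Fin 4 ⊕ BV τ) : Prop :=
  (inClLoc loc μ τ 2 s u ∧ inClLoc loc μ τ 2 s v ∧ ∃ e, s e = false ∧ (loc τ).Joins e u v) ∨
    ((inClLoc loc μ τ 2 s u ↔ ¬ inClLoc loc μ τ 2 s v) ∧ ∃ e, (loc τ).Joins e u v) ∨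
      (¬ inClLoc loc μ τ 2 s u ∧ ¬ inClLoc loc μ τ 2 s v ∧ (loc τ).Conn s u v)

/-- `hadjLoc` is decidable. -/
instance (μ : Mode) (τ : C) (s : BE τ → Bool) (u v : Fin 4 ⊕ BV τ) :
    Decidable (hadjLoc loc μ τ s u v) := by
  unfold hadjLoc; infer_instance

omit [∀ τ, DecidableEq (BE τ)] in
/-- Within-branch H-steps are symmetric. -/
theorem hadjLoc_symm (μ : Mode) (τ : C) (s : BE τ → Bool) {u v : Fin 4 ⊕ BV τ}
    (h : hadjLoc loc μ τ s u v) : hadjLoc loc μ τ s v u := by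
  unfold hadjLoc at h ⊢
  have hj : ∀ e, (loc τ).Joins e u v → (loc τ).Joins e v u := fun e he => by
    rcases he with ⟨h1, h2⟩ | ⟨h1, h2⟩
    · exact Or.inr ⟨h1, h2⟩
    · exact Or.inl ⟨h1, h2⟩
  rcases h with ⟨h1, h2, e, he, hj'⟩ | ⟨h1, e, hj'⟩ | ⟨h1, h2, h3⟩
  · exact Or.inl ⟨h2, h1, e, he, hj e hj'⟩
  · refine Or.inr (Or.inl ⟨?_, e, hj e hj'⟩)
    constructor
    · intro hv hu; exact h1.1 hu hv
    · intro hnu; by_contra hnv; exact hnu (h1.2 hnv)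
  · exact Or.inr (Or.inr ⟨h2, h1, h3.symm⟩)

/-- Within-branch H-walks avoiding `X`. -/
def hconnAvoidLoc (μ : Mode) (τ : C) (X : Option (Fin 3)) (s : BE τ → Bool) (u v : Fin 4 ⊕ BV τ) :
    Prop :=
  Relation.ReflTransGen
    (fun x y => hadjLoc loc μ τ s x y ∧ ¬ inXLoc loc μ τ X s x ∧ ¬ inXLoc loc μ τ X s y) u v

omit [∀ τ, DecidableEq (BE τ)] in
/-- `hconnAvoidLoc` is reachability in a finite symmetric graph, hence decidable. -/
theorem hconnAvoidLoc_iff_reachable (μ : Mode) (τ : C) (X : Option (Fin 3)) (s : BE τ → Bool)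
    (u v : Fin 4 ⊕ BV τ) :
    hconnAvoidLoc loc μ τ X s u v ↔ (SimpleGraph.fromRel fun x y =>
      hadjLoc loc μ τ s x y ∧ ¬ inXLoc loc μ τ X s x ∧ ¬ inXLoc loc μ τ X s y).Reachable u v :=
  reflTransGen_iff_reachable_fromRel (fun _ _ h => ⟨hadjLoc_symm loc μ τ s h.1, h.2.2, h.2.1⟩) u v

/-- `hconnAvoidLoc` is decidable. -/
instance (μ : Mode) (τ : C) (X : Option (Fin 3)) (s : BE τ → Bool) (u v : Fin 4 ⊕ BV τ) :
    Decidable (hconnAvoidLoc loc μ τ X s u v) :=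
  decidable_of_iff' _ (hconnAvoidLoc_iff_reachable loc μ τ X s u v)

/-- The detour fact of the pair of terminals `(i, j)` avoiding `X`: a within-branch H-walk. -/
def Dloc (μ : Mode) (τ : C) (X : Option (Fin 3)) (i j : Fin 4) (s : BE τ → Bool) : Prop :=
  hconnAvoidLoc loc μ τ X s (.inl i) (.inl j)

/-- `Dloc` is decidable. -/
instance (μ : Mode) (τ : C) (X : Option (Fin 3)) (i j : Fin 4) (s : BE τ → Bool) :
    Decidable (Dloc loc μ τ X i j s) := by
  unfold Dloc; infer_instance

end Local

end PercRepro.CatGraph
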